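import Mathlib
import HarnessLib
import Summits.Ventures.LatticeQCDFlow.Scaling.PerfectRelaxationVolumeLength

/-!
# LatticeQCDFlow / Scaling — ACHIEVABILITY: `Θ(m)` layers suffice AND are needed (v2.5)

HONEST FRAMING: exact (Metropolis-corrected) sampling algorithms for lattice gauge theory; figures
of merit are autocorrelation/cost numbers at stated couplings and volumes; no continuum-physics
claim.

Venture `LatticeQCDFlow` (cell pub-lqcd), topic `Scaling`, FANOUT row 29 (theory2) — OUR WORK
(THEORY-2.md v2.5 §3.5 (vii) / §4 row C3).  Finite-state, elementary; nothing is cited as a fact.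
Imports `PerfectRelaxationVolumeLength` (items 27, 28, 28b of `lean/theory2/LANDING.md` §11).

The LAYER-COUNT LAW (`HellingerLength`, `PerfectRelaxationVolumeLength`) is a LOWER bound on the
number of layers: `ÊSS ≤ exp(−m·‖√p_n − √p_0‖²_site/n)`.  This file proves the matching UPPER
bound on the cost, i.e. a LOWER bound on the ESS, for the simplest schedule:

* `essFrac_expFamily_ge` — for an exponential family `p_β ∝ e^{−βA}` on a finite set with
  `a ≤ A ≤ b`:  **`ESS(p_{β+h}, p_β) ≥ exp(−h²(b − a)²/4)`**.  Proof: `ESS(p_{β+h}, p_β) =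
  Z_{β+h}²/(Z_β Z_{β+2h}) = 1/(E_{β+h}[e^{hA}]·E_{β+h}[e^{−hA}])` (`essFrac_expFamily_eq_inv`), and
  for `|Y| ≤ r`, `E[e^{tY}]·E[e^{−tY}] ≤ cosh(tr)² ≤ e^{t²r²}` (`mgf_mul_mgf_neg_le_cosh_sq`: the
  chord bound `e^{tx} ≤ cosh(tr) + (x/r)·sinh(tr)` on `[−r, r]` from `convexOn_exp`, the two means
  cancel in the product; then Mathlib `Real.cosh_le_exp_half_sq`), applied to `Y = A − (a+b)/2`,
  `r = (b−a)/2`.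
* `prod_essFrac_unif_ge` — along the UNIFORM protocol `β_k = β₀ + kΔ/n`:
  `Π_{k<n} ESS(p_{k+1}, p_k) ≥ exp(−Δ²(b − a)²/(4n))`.
* `perfectRelaxation_sites_two_sided` — `m` independent sites, uniform protocol, PERFECT relaxation
  (each layer resamples its target exactly; tree `ess_perfect_relaxation`):
  **`exp(−m·Δ²(b−a)²/(4n)) ≤ ÊSS ≤ exp(−m·‖√p_n − √p_0‖²_site/n)`**.
  So for this class the number of layers needed for a fixed ÊSS is `Θ(m)`: at least
  `m‖√p_n − √p_0‖²_site/log(1/ÊSS)` (necessary for ALL sitewise-monotone layers, file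
  `PerfectRelaxationVolumeLength`) and at most `mΔ²(b−a)²/(4·log(1/ÊSS))` (sufficient with perfect
  relaxation) — LINEAR IN THE VOLUME on both sides, with explicit single-site constants.
-/

noncomputable section

namespace Summit.Ventures.LatticeQCDFlow.Theory2

open Finset Summit.Ventures.LatticeQCDFlow.Exactness

variable {X : Type*} [Fintype X]

/-! ## A Hoeffding-type product bound via the chord of `exp` -/

/-- The chord bound for `exp` on `[−r, r]`: `e^{tx} ≤ cosh(tr) + (x/r)·sinh(tr)` for `|x| ≤ r`.
[folklore] -/
theorem exp_mul_le_cosh_add (t : ℝ) {r x : ℝ} (hr : 0 < r) (hx : |x| ≤ r) :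
    Real.exp (t * x) ≤ Real.cosh (t * r) + x / r * Real.sinh (t * r) := by
  obtain ⟨hx1, hx2⟩ := abs_le.1 hx
  have ha : 0 ≤ (r + x) / (2 * r) := div_nonneg (by linarith) (by linarith)
  have hb : 0 ≤ (r - x) / (2 * r) := div_nonneg (by linarith) (by linarith)
  have hab : (r + x) / (2 * r) + (r - x) / (2 * r) = 1 := by
    field_simp
    ring
  have h := convexOn_exp.2 (Set.mem_univ (t * r)) (Set.mem_univ (-(t * r))) ha hb hab
  simp only [smul_eq_mul] at h
  have harg : (r + x) / (2 * r) * (t * r) + (r - x) / (2 * r) * -(t * r) = t * x := by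
    field_simp
    ring
  rw [harg] at h
  refine h.trans (le_of_eq ?_)
  rw [Real.cosh_eq, Real.sinh_eq]
  field_simp
  ring

/-- **`E[e^{tY}]·E[e^{−tY}] ≤ cosh(tr)²` for `|Y| ≤ r` under a probability vector** (the two
chord bounds have opposite linear terms, which cancel in the product up to a negative square).
[folklore] -/
theorem mgf_mul_mgf_neg_le_cosh_sq (π Y : X → ℝ) (hπ : ∀ x, 0 ≤ π x) (hπ1 : ∑ x, π x = 1)
    (t : ℝ) {r : ℝ} (hr : 0 < r) (hY : ∀ x, |Y x| ≤ r) :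
    (∑ x, π x * Real.exp (t * Y x)) * (∑ x, π x * Real.exp (-(t * Y x))) ≤
      Real.cosh (t * r) ^ 2 := by
  set C := Real.cosh (t * r)
  set S := Real.sinh (t * r)
  set μ := ∑ x, π x * Y x
  have hplus : ∑ x, π x * Real.exp (t * Y x) ≤ C + S / r * μ := by
    calc ∑ x, π x * Real.exp (t * Y x) ≤ ∑ x, π x * (C + Y x / r * S) :=
          sum_le_sum fun x _ => mul_le_mul_of_nonneg_left (exp_mul_le_cosh_add t hr (hY x)) (hπ x)
      _ = C + S / r * μ := by
          have : ∀ x, π x * (C + Y x / r * S) = C * π x + S / r * (π x * Y x) := fun x => by ring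
          simp_rw [this, sum_add_distrib, ← mul_sum, hπ1, mul_one]
          rfl
  have hminus : ∑ x, π x * Real.exp (-(t * Y x)) ≤ C - S / r * μ := by
    calc ∑ x, π x * Real.exp (-(t * Y x)) ≤ ∑ x, π x * (C + -Y x / r * S) :=
          sum_le_sum fun x _ => by
            refine mul_le_mul_of_nonneg_left ?_ (hπ x)
            have := exp_mul_le_cosh_add t hr (show |-Y x| ≤ r by rw [abs_neg]; exact hY x)
            rwa [mul_neg] at this
      _ = C - S / r * μ := by
          have : ∀ x, π x * (C + -Y x / r * S) = C * π x - S / r * (π x * Y x) := fun x => by ring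
          simp_rw [this, sum_sub_distrib, ← mul_sum, hπ1, mul_one]
          rfl
  have hμ : |μ| ≤ r := by
    calc |μ| ≤ ∑ x, |π x * Y x| := abs_sum_le_sum_abs _ _
      _ ≤ ∑ x, π x * r := sum_le_sum fun x _ => by
          rw [abs_mul, abs_of_nonneg (hπ x)]
          exact mul_le_mul_of_nonneg_left (hY x) (hπ x)
      _ = r := by rw [← sum_mul, hπ1, one_mul]
  have hu : (S / r * μ) ^ 2 ≤ C ^ 2 := by
    have h1 : (μ / r) ^ 2 ≤ 1 := by
      rw [sq_le_one_iff_abs_le_one, abs_div, abs_of_pos hr, div_le_one hr]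
      exact hμ
    calc (S / r * μ) ^ 2 = S ^ 2 * (μ / r) ^ 2 := by
          field_simp
      _ ≤ S ^ 2 * 1 := mul_le_mul_of_nonneg_left h1 (sq_nonneg _)
      _ ≤ C ^ 2 := by rw [Real.cosh_sq]; linarith
  have ha0 : 0 ≤ C + S / r * μ := by
    have := (abs_le_of_sq_le_sq' hu (Real.cosh_pos _).le).1
    linarith
  have hB0 : 0 ≤ ∑ x, π x * Real.exp (-(t * Y x)) :=
    sum_nonneg fun x _ => mul_nonneg (hπ x) (Real.exp_pos _).le
  calc (∑ x, π x * Real.exp (t * Y x)) * (∑ x, π x * Real.exp (-(t * Y x)))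
      ≤ (C + S / r * μ) * (C - S / r * μ) := mul_le_mul hplus hminus hB0 ha0
    _ = C ^ 2 - (S / r * μ) ^ 2 := by ring
    _ ≤ C ^ 2 := by linarith [sq_nonneg (S / r * μ)]

/-! ## Exponential families: `ESS(p_{β+h}, p_β) ≥ exp(−h²(b−a)²/4)` -/

section ExpFamily

variable [Nonempty X]

/-- `ESS(p_{β+h}, p_β) = 1/(E_{β+h}[e^{hA}]·E_{β+h}[e^{−hA}])` for `p_β ∝ e^{−βA}`. [folklore] -/
theorem essFrac_expFamily_eq_inv (A : X → ℝ) (β h : ℝ) :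
    essFrac (gibbsLaw fun x => (β + h) * A x) (gibbsLaw fun x => β * A x) =
      ((∑ x, gibbsLaw (fun x => (β + h) * A x) x * Real.exp (h * A x)) *
        ∑ x, gibbsLaw (fun x => (β + h) * A x) x * Real.exp (-(h * A x)))⁻¹ := by
  rw [essFrac_eq_inv (gibbsLaw_pos _) (sum_gibbsLaw _)]
  congr 1
  have hZ₁ : 0 < partitionFn fun x => (β + h) * A x := partitionFn_pos _
  have hZ₀ : 0 < partitionFn fun x => β * A x := partitionFn_pos _
  -- left: Σ p²/q = (Z₀/Z₁²)·Σ e^{−(β+2h)A}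
  have hl : ∑ x, gibbsLaw (fun x => (β + h) * A x) x *
      weight (gibbsLaw fun x => (β + h) * A x) (gibbsLaw fun x => β * A x) x =
        (partitionFn fun x => β * A x) / (partitionFn fun x => (β + h) * A x) ^ 2 *
          ∑ x, Real.exp (-((β + 2 * h) * A x)) := by
    rw [mul_sum]
    refine sum_congr rfl fun x _ => ?_
    simp only [weight, gibbsLaw]
    have he : Real.exp (-((β + 2 * h) * A x)) =
        Real.exp (-((β + h) * A x)) * Real.exp (-((β + h) * A x)) / Real.exp (-(β * A x)) := by
      rw [← Real.exp_add, ← Real.exp_sub]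
      congr 1
      ring
    rw [he]
    field_simp
  -- right: E₁[e^{hA}] = Z₀/Z₁ and E₁[e^{−hA}] = (Σ e^{−(β+2h)A})/Z₁
  have hr1 : ∑ x, gibbsLaw (fun x => (β + h) * A x) x * Real.exp (h * A x) =
      (partitionFn fun x => β * A x) / partitionFn fun x => (β + h) * A x := by
    simp only [gibbsLaw, div_mul_eq_mul_div, ← sum_div]
    congr 1
    refine sum_congr rfl fun x _ => ?_
    rw [← Real.exp_add]
    congr 1
    ring
  have hr2 : ∑ x, gibbsLaw (fun x => (β + h) * A x) x * Real.exp (-(h * A x)) =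
      (∑ x, Real.exp (-((β + 2 * h) * A x))) / partitionFn fun x => (β + h) * A x := by
    simp only [gibbsLaw, div_mul_eq_mul_div, ← sum_div]
    congr 1
    refine sum_congr rfl fun x _ => ?_
    rw [← Real.exp_add]
    congr 1
    ring
  rw [hl, hr1, hr2]
  field_simp

/-- **`ESS(p_{β+h}, p_β) ≥ exp(−h²(b − a)²/4)`** for `p_β ∝ e^{−βA}` with `a ≤ A ≤ b`: one
annealing step of size `h` in an exponential family costs at most `h²·osc(A)²/4` in `−log ESS`.
[folklore] -/
theorem essFrac_expFamily_ge (A : X → ℝ) {a b : ℝ} (hab : a < b) (hA : ∀ x, a ≤ A x ∧ A x ≤ b)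
    (β h : ℝ) :
    Real.exp (-(h ^ 2 * (b - a) ^ 2 / 4)) ≤
      essFrac (gibbsLaw fun x => (β + h) * A x) (gibbsLaw fun x => β * A x) := by
  set g := gibbsLaw fun x => (β + h) * A x
  set c := (a + b) / 2
  set r := (b - a) / 2
  have hr : 0 < r := by simp only [r]; linarith
  have hY : ∀ x, |A x - c| ≤ r := fun x => by
    rw [abs_le]
    constructor <;> simp only [c, r] <;> linarith [(hA x).1, (hA x).2]
  have hg0 : ∀ x, 0 ≤ g x := fun x => (gibbsLaw_pos _ x).le
  have hg1 : ∑ x, g x = 1 := sum_gibbsLaw _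
  -- factor out `e^{±hc}`
  have hM : (∑ x, g x * Real.exp (h * A x)) * (∑ x, g x * Real.exp (-(h * A x))) =
      (∑ x, g x * Real.exp (h * (A x - c))) * ∑ x, g x * Real.exp (-(h * (A x - c))) := by
    have e1 : ∀ x, Real.exp (h * A x) = Real.exp (h * c) * Real.exp (h * (A x - c)) := fun x => by
      rw [← Real.exp_add]; congr 1; ring
    have e2 : ∀ x, Real.exp (-(h * A x)) = Real.exp (-(h * c)) * Real.exp (-(h * (A x - c))) :=
      fun x => by rw [← Real.exp_add]; congr 1; ring
    simp_rw [e1, e2, mul_left_comm (g _) (Real.exp _), ← mul_sum]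
    rw [mul_mul_mul_comm, ← Real.exp_add, show h * c + -(h * c) = 0 by ring, Real.exp_zero, one_mul]
  have hMle : (∑ x, g x * Real.exp (h * A x)) * (∑ x, g x * Real.exp (-(h * A x))) ≤
      Real.exp (h ^ 2 * (b - a) ^ 2 / 4) := by
    rw [hM]
    refine (mgf_mul_mgf_neg_le_cosh_sq g (fun x => A x - c) hg0 hg1 h hr hY).trans ?_
    calc Real.cosh (h * r) ^ 2 ≤ Real.exp ((h * r) ^ 2 / 2) ^ 2 :=
          pow_le_pow_left₀ (Real.cosh_pos _).le (Real.cosh_le_exp_half_sq _) 2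
      _ = Real.exp (h ^ 2 * (b - a) ^ 2 / 4) := by
          rw [← Real.exp_nat_mul]
          congr 1
          simp only [r]
          push_cast
          ring
  have hMpos : 0 < (∑ x, g x * Real.exp (h * A x)) * ∑ x, g x * Real.exp (-(h * A x)) :=
    mul_pos (sum_pos (fun x _ => mul_pos (gibbsLaw_pos _ x) (Real.exp_pos _)) univ_nonempty)
      (sum_pos (fun x _ => mul_pos (gibbsLaw_pos _ x) (Real.exp_pos _)) univ_nonempty)
  rw [essFrac_expFamily_eq_inv, Real.exp_neg]
  exact inv_anti₀ hMpos hMle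

/-! ## The uniform protocol `β_k = β₀ + kΔ/n` -/

/-- The uniform annealing protocol `β_k = β₀ + k·Δ/n`, `k = 0, …, n`. [folklore] -/
def unifProtocol (β₀ Δ : ℝ) (n : ℕ) (k : Fin (n + 1)) : ℝ := β₀ + k * (Δ / n)

/-- `β_{k+1} = β_k + Δ/n`. [folklore] -/
theorem unifProtocol_succ (β₀ Δ : ℝ) {n : ℕ} (k : Fin n) :
    unifProtocol β₀ Δ n k.succ = unifProtocol β₀ Δ n k.castSucc + Δ / n := by
  simp only [unifProtocol, Fin.val_succ, Fin.val_castSucc, Nat.cast_add, Nat.cast_one]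
  ring

/-- The uniform protocol is monotone for `Δ ≥ 0`. [folklore] -/
theorem unifProtocol_monotone (β₀ : ℝ) {Δ : ℝ} (hΔ : 0 ≤ Δ) (n : ℕ) :
    Monotone (unifProtocol β₀ Δ n) := fun i j hij => by
  simp only [unifProtocol]
  have : (i : ℝ) ≤ (j : ℝ) := by exact_mod_cast hij
  have hn : 0 ≤ Δ / n := div_nonneg hΔ (Nat.cast_nonneg _)
  nlinarith

/-- **ACHIEVABILITY, single site**: along the uniform protocol the perfect-relaxation product
satisfies `Π_{k<n} ESS(p_{k+1}, p_k) ≥ exp(−Δ²(b − a)²/(4n))`. [folklore] -/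
theorem prod_essFrac_unif_ge (A : X → ℝ) {a b : ℝ} (hab : a < b) (hA : ∀ x, a ≤ A x ∧ A x ≤ b)
    (β₀ Δ : ℝ) {n : ℕ} (hn : 0 < n) :
    Real.exp (-(Δ ^ 2 * (b - a) ^ 2 / (4 * n))) ≤
      ∏ k : Fin n, essFrac (gibbsLaw fun x => unifProtocol β₀ Δ n k.succ * A x)
        (gibbsLaw fun x => unifProtocol β₀ Δ n k.castSucc * A x) := by
  have hn' : (0 : ℝ) < n := by exact_mod_cast hn
  have hstep : ∀ k : Fin n, Real.exp (-((Δ / n) ^ 2 * (b - a) ^ 2 / 4)) ≤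
      essFrac (gibbsLaw fun x => unifProtocol β₀ Δ n k.succ * A x)
        (gibbsLaw fun x => unifProtocol β₀ Δ n k.castSucc * A x) := fun k => by
    simp_rw [unifProtocol_succ]
    exact essFrac_expFamily_ge A hab hA _ _
  calc Real.exp (-(Δ ^ 2 * (b - a) ^ 2 / (4 * n)))
      = Real.exp (-((Δ / n) ^ 2 * (b - a) ^ 2 / 4)) ^ n := by
        rw [← Real.exp_nat_mul]
        congr 1
        field_simp
    _ = ∏ _k : Fin n, Real.exp (-((Δ / n) ^ 2 * (b - a) ^ 2 / 4)) := by
        rw [prod_const, card_univ, Fintype.card_fin]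
    _ ≤ _ := prod_le_prod (fun _ _ => (Real.exp_pos _).le) fun k _ => hstep k

/-- **ACHIEVABILITY for perfectly relaxing NE-MCMC / SNF, single site**: along the uniform
protocol `ÊSS ≥ exp(−Δ²(b − a)²/(4n))` (tree `ess_perfect_relaxation`). [folklore] -/
theorem ess_perfect_relaxation_unif_ge [DecidableEq X] (A : X → ℝ) {a b : ℝ} (hab : a < b)
    (hA : ∀ x, a ≤ A x ∧ A x ≤ b) (β₀ Δ : ℝ) {n : ℕ} (hn : 0 < n) :
    Real.exp (-(Δ ^ 2 * (b - a) ^ 2 / (4 * n))) ≤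
      essFrac
        (revPathLaw (fun k x => unifProtocol β₀ Δ n k * A x) fun k _ y =>
          gibbsLaw (fun x => unifProtocol β₀ Δ n k.succ * A x) y)
        (pathLaw (gibbsLaw fun x => unifProtocol β₀ Δ n 0 * A x) fun k _ y =>
          gibbsLaw (fun x => unifProtocol β₀ Δ n k.succ * A x) y) := by
  rw [ess_perfect_relaxation (fun k x => unifProtocol β₀ Δ n k * A x)]
  exact prod_essFrac_unif_ge A hab hA β₀ Δ hn

end ExpFamily

/-! ## `m` independent sites: the two-sided volume × layer-count law -/

section Sites

variable {Z : Type*} [LinearOrder Z] [Fintype Z] [Nonempty Z] {m n : ℕ}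

/-- PERFECT RELAXATION on `m` independent sites: the path ESS is the `m`-th power of the
single-site perfect-relaxation product (tree `ess_perfect_relaxation` on `Fin m → Z`,
`gibbsLaw_siteSum`, tree `essFrac_blockProd_const`). [folklore] -/
theorem ess_perfect_relaxation_sites (m : ℕ) (A : Z → ℝ) (β : Fin (n + 1) → ℝ) :
    essFrac
        (revPathLaw (siteSum m A β) fun k _ ψ => gibbsLaw (siteSum m A β k.succ) ψ)
        (pathLaw (gibbsLaw (siteSum m A β 0)) fun k _ ψ => gibbsLaw (siteSum m A β k.succ) ψ) =
      (∏ k : Fin n, essFrac (gibbsLaw fun z => β k.succ * A z)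
        (gibbsLaw fun z => β k.castSucc * A z)) ^ m := by
  rw [ess_perfect_relaxation (siteSum m A β), ← prod_pow]
  refine prod_congr rfl fun k _ => ?_
  rw [gibbsLaw_siteSum, gibbsLaw_siteSum]
  exact essFrac_blockProd_const (gibbsLaw_pos _) (sum_gibbsLaw _) m

/-- **THE TWO-SIDED VOLUME × LAYER-COUNT LAW for perfect relaxation (proved).**  `m` independent
sites, single-site exponential family `∝ e^{−βA}` with `a ≤ A ≤ b` (no monotonicity needed
here), uniform protocol `β_k = β₀ + kΔ/n` (`n ≥ 1`, any `Δ`), every layer resampling its target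
exactly:
`exp(−m·Δ²(b−a)²/(4n)) ≤ ÊSS ≤ exp(−m·‖√p_n − √p_0‖²_site/n)`.  Both exponents are LINEAR IN
THE VOLUME `m` and inverse in the number of layers `n`: `Θ(m)` layers are necessary (for all
sitewise-monotone layers, `perfectRelaxation_volume_length_law`) and sufficient (here).
[folklore] -/
theorem perfectRelaxation_sites_two_sided (m : ℕ) (A : Z → ℝ) {a b : ℝ} (hab : a < b)
    (hA : ∀ z, a ≤ A z ∧ A z ≤ b) (β₀ Δ : ℝ) (hn : 0 < n) :
    Real.exp (-((m : ℝ) * (Δ ^ 2 * (b - a) ^ 2 / (4 * n)))) ≤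
        essFrac
          (revPathLaw (siteSum m A (unifProtocol β₀ Δ n)) fun k _ ψ =>
            gibbsLaw (siteSum m A (unifProtocol β₀ Δ n) k.succ) ψ)
          (pathLaw (gibbsLaw (siteSum m A (unifProtocol β₀ Δ n) 0)) fun k _ ψ =>
            gibbsLaw (siteSum m A (unifProtocol β₀ Δ n) k.succ) ψ) ∧
      essFrac
          (revPathLaw (siteSum m A (unifProtocol β₀ Δ n)) fun k _ ψ =>
            gibbsLaw (siteSum m A (unifProtocol β₀ Δ n) k.succ) ψ)
          (pathLaw (gibbsLaw (siteSum m A (unifProtocol β₀ Δ n) 0)) fun k _ ψ =>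
            gibbsLaw (siteSum m A (unifProtocol β₀ Δ n) k.succ) ψ) ≤
        Real.exp (-((m : ℝ) * ‖sqrtVec (gibbsLaw fun z => unifProtocol β₀ Δ n (Fin.last n) * A z) -
          sqrtVec (gibbsLaw fun z => unifProtocol β₀ Δ n 0 * A z)‖ ^ 2 / n)) := by
  rw [ess_perfect_relaxation_sites]
  refine ⟨?_, prod_essFrac_pow_le_exp hn m A _⟩
  rw [show -((m : ℝ) * (Δ ^ 2 * (b - a) ^ 2 / (4 * n))) =
      (m : ℕ) * (-(Δ ^ 2 * (b - a) ^ 2 / (4 * n))) by ring, Real.exp_nat_mul]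
  exact pow_le_pow_left₀ (Real.exp_pos _).le (prod_essFrac_unif_ge A hab hA β₀ Δ hn) m

end Sites

end Summit.Ventures.LatticeQCDFlow.Theory2

end
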